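import Summits.QuantumFields.BalabanUV.T4Continuum.Spine.NE3.PairLandauB8Avg
import Summits.QuantumFields.BalabanUV.T4Continuum.Support.NE3ProductPathChartSlice
import Summits.QuantumFields.BalabanUV.T4Continuum.Support.NE3EndpointPackageOfDecomposedRep
import HarnessLib

/-!
# T⁴ programme, node NE3 — REPAIR R3, THE END ON B8's SURFACE: the covariant root `NE3EnergyRateWCov` FROM [Balaban1985RegularSpaces] Thm 2 at the
# pair WITH (1.37) (`PairLandauGaugeB8Avg`) AND, per pair, a DECOMPOSED REPRESENTATIVE on B8's tangent slice `slicB8` starting at the B8 direction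
# (`DecomposedRepT … (slicB8 …) …`, `pathΓ X N 0 = Z`), (P♮) and (RES♯) on `slicB8`, and k-free letters — so the remaining inputs of NE3's local
# half are EXACTLY the census rows R24 (chart supplier) and R25 ((P♮) = [Balaban1985BackgroundPropagators] Thm 3.3 TYPE, (RES♯)) and nothing else

Cell `pub-balaban-gaps` (YM blitz, track G2, seat `ne3`, unit `pub-balaban-gaps-ne3`; writer prover-pub-balaban-gaps-ne3-g2-0, 2026-08-22), repair R3 of
`run/shared/lean/pub/pub-balaban-gaps/ne/NE3.md` §4∕§6 (5): the END of the B8-surface branch.  Inputs BY NAME (all landed): `Spine/NE3/PairLandauB8`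
(p340877: `LandauRepB8`, `IsLandauB8`, `rpow_two_add_one`), `Spine/NE3/PairLandauB8Avg` (p341788: `LandauRepB8Avg`, `PairLandauGaugeB8Avg`, `slicB8`,
`skew_of_mem_slicB8`, `periodic_of_mem_slicB8`), `Support/NE3EnergyRateWCovOfEndpointChart` (p340269: the slice-generic END
`ne3EnergyRateWCov_of_endpointChart_slice`), `Support/NE3ProductPathChartSlice` (p341346: `DecomposedRepT`, `endpointChart_of_decomposedRepT`), the owner's
`Support/NE3EndpointPackageOfDecomposedRep` (`extPath`, `endpointChart_congr_path`, `norm_extPath_le`: the product path extended by `0` outside `(−1∕4, 5∕4)`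
so that the END's global sup clause holds) and `NE3EnergyRateWSupOfSlicePoincare.cLambda`.

CONTENT (0 sorry, no `def`; [folklore] bookkeeping):
**`ne3EnergyRateWCov_of_pairLandauGaugeB8Avg`** (class-generic; `d ≥ 1`, `L, N ≥ 1`).  HYPOTHESES: `hB8 : PairLandauGaugeB8Avg d 𝒞 L N b g s₁ s₂ 1 dom`
([B8] Thm 2 ∘ [B11] Thm 1 READ at the pair with (1.37), `β = 1` per caveat (c2)); `hsupp` — for every level `k ≥ 1`, datum `V ∈ dom`, minimiser pair
`(U_A, U_B)` with `U_B` `(b, g)`-regular and EVERY representative `(u, Z)` with `LandauRepB8Avg L N k W U_A u Z s₁ s₂ 1` (`W = cavg L U_B`): `W` is unitary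
and there are `X N α αN a` with `DecomposedRepT 𝒞 L N k V U_A U_B u X N (slicB8 L N k W) α αN ν κ₁ κ₂ a` (route Π's decomposition ON B8's SLICE, uniform
letters `ν, κ₁, κ₂`), `pathΓ X N 0 = Z` (the product path STARTS at the B8 direction), `α ≤ 1∕40`, `αN ≤ 1∕100`, the level lines
(J1) `(1 + 24√d(e^{10(α+αN)} − 1)L^k)² + 48·d·a·(L^k)² ≤ Λ`, (J2) `112·d·a·CP·(L^k)² ≤ 1∕(2·card n)`, (P♮) `SlicePoincare L k W (slicB8 L N k W) CP (periodBox (N·L^k))`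
and (RES♯) `CurlPairedResidual L k W (slicB8 L N k W) (C′·residualScale d L N b g k) (periodBox (N·L^k))`; uniformly `0 ≤ CP`, `CP·(√Λ−1)² ≤ 1∕4`, `0 ≤ ν`,
`0 ≤ C′` and the budget `2Λθ + Λθ² + κ ≤ cΛ∕2` for the DISPLAYED k-free letters `θ = 2(1 + 4√(16d+1))·ν`, `κ = 2κ₁ + 912·d·κ₂`.  CONCLUSION:
**`NE3EnergyRateWCov d 𝒞 L N b g ((1 + θ₀)·(4∕cΛ)·C′) s₁ s₂ dom`**, `θ₀ = ν + 23√2·√(16d+1)·(1+ν)`.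
PROOF = composition by name: `hB8.perPair` → `hsupp` → `endpointChart_of_decomposedRepT` → `endpointChart_congr_path` with `extPath` (global sup `10(α+αN)`,
`norm_extPath_le`) → `ne3EnergyRateWCov_of_endpointChart_slice`, the (Lip₁ᶜ)∕(Lip₂′ᶜ) clauses read off `extPath X N 0 = pathΓ X N 0 = Z` from
`LandauRepB8.grad`∕`.holder` (`β = 1`, `rpow_two_add_one`).

WHAT THIS END DISPLAYS AS THE WHOLE REMAINING WORK OF NE3's LOCAL HALF ON B8's SURFACE (census `ne/NE3.md` §4): R24 = the supplier `hsupp` minus its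
last two conjuncts (the decomposition `Z = N − X`, `X ∈ slicB8(W)`, with the three sizes of `N` — route Π's Π-C∕Π-R rows re-run for the linearised
double-bar average `QbarIter`); R25 = (P♮) on `slicB8` (printed TYPE [Balaban1985BackgroundPropagators] Thm 3.3 (3.46)–(3.47), to be taken as a
hypothesis per the cell's rule) and (RES♯) on `slicB8` (kernel; `NE3PureGaugeFirstVariation.dAction_gaugeDir` kills the exact gauge component, the
tangent projection bound is k-free exactly at `d = 4`); plus the printed-TYPE inputs already named by the row ((H∃) = [Balaban1985Variational] Thm 1,
hidden in `IsMinimiser`∕`Regular` data and in `PairLandauGaugeB8Avg` itself).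

HONEST FRAMING.  An implication; every hypothesis is OPEN for Bałaban's minimisers; NOTHING of Bałaban's is proved; the covariant root and **NE3 are NOT
proved**; spine PROVED 0∕9; finite T⁴ rung (B)+1 — NOT infinite volume, NOT mass gap, NOT `BetaPertH`, NOT Clay.  ABSOLUTE RULE kept: no printed
sentence is a hypothesis — the B8∕B11 TYPES enter through the `def` `PairLandauGaugeB8Avg` by name.  PLACEMENT: `Summits/QuantumFields/BalabanUV/T4Continuum/
Spine/NE3/`; imports accepted modules only; moves nothing.  HONEST DEPENDENCY (cell page 1): continuum YM on T⁴ ⇐ BetaPertH ∧ nine spine estimates (0/9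
proved); BetaPertH ⇐ (D1) ∧ (D4) ∧ CAP+tail; G-an2-4 gates asym, D1 and NE2/3/4.
-/

set_option autoImplicit false

open scoped BigOperators Matrix Matrix.Norms.L2Operator
open NormedSpace Finset

namespace Summit.QuantumFields.BalabanUV.T4Continuum.NE3.PairLandauB8End

open Set
open Literature.MathematicalPhysics.QuantumFieldTheory.Balaban1983to89
open B7Prop1Explicit B7Prop2Explicit
open T4AveragingDeficitWall hiding Site Plane Plaq Bond
open T4AveragingDeficitWallBoundary (IsPeriodicCfg periodBox)
open AveragingDeficitPeriodicCounting (IsPeriodicDir)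
open AveragingDeficitChartCalculus (cavg)
open MinimalActionSandwich (IsMinimiser)
open MinimalActionRate (Regular)
open NE3EnergyShapes (residualScale residualScale_nonneg IsUnitarySite IsPeriodicSite)
open NE3EnergyWeightedShapes (energyNormW CurlPairedResidual)
open NE3EnergyWeightedCovShape (NE3EnergyRateWCov)
open NE3SlicePoincareShape (SlicePoincare)
open NE3EndpointChart (EndpointChart)
open NE3EnergyRateWSupOfSlicePoincare (cLambda)
open NE3EnergyRateWCovOfEndpointChart (ne3EnergyRateWCov_of_endpointChart_slice)
open NE3ProductPath (pathΓ vel acc)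
open NE3ProductPathChartSlice (DecomposedRepT endpointChart_of_decomposedRepT)
open NE3EndpointPackageOfDecomposedRep (extPath extPath_of_mem mem_window_of_mem_Icc isSkewDir_extPath isPeriodicDir_extPath norm_extPath_le
  endpointChart_congr_path)
open NE3.PairLandauB8 (LandauRepB8 rpow_two_add_one)
open NE3.PairLandauB8Avg (LandauRepB8Avg PairLandauGaugeB8Avg slicB8 skew_of_mem_slicB8 periodic_of_mem_slicB8)

noncomputable section

variable {d : ℕ} {n : Type*} [Fintype n] [DecidableEq n]

/-- **THE END ON B8's SURFACE — `NE3EnergyRateWCov` ⇐ `PairLandauGaugeB8Avg` ∧ (per pair, per representative) `DecomposedRepT` ON `slicB8` STARTING AT THE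
B8 DIRECTION ∧ (P♮)∕(RES♯) ON `slicB8` ∧ k-FREE LETTERS** (class-generic; `d ≥ 1`, `L, N ≥ 1`; see the module docstring for the hypothesis list and for what
it displays as open).  Composition by name over the slice-generic END (p340269), the slice-generic product-path chart (p341346) and the owner's
zero-extension of the path (`NE3EndpointPackageOfDecomposedRep`). [folklore] -/
theorem ne3EnergyRateWCov_of_pairLandauGaugeB8Avg [Nonempty n] (hd : 1 ≤ d) {𝒞 : ℕ → Set (Site d → Fin d → (Matrix n n ℂ)ˣ)}
    {L N : ℕ} (hL : 1 ≤ L) (hN : 1 ≤ N) {b g s₁ s₂ : ℝ} {dom : Set (Site d → Fin d → (Matrix n n ℂ)ˣ)}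
    {ν κ₁ κ₂ CP Λ C' : ℝ} (hCP : 0 ≤ CP) (hreg₁ : CP * (Real.sqrt Λ - 1) ^ 2 ≤ 1 / 4) (hν : 0 ≤ ν) (hC' : 0 ≤ C')
    (hbudget : 2 * Λ * (2 * (1 + 4 * Real.sqrt (16 * d + 1)) * ν) + Λ * (2 * (1 + 4 * Real.sqrt (16 * d + 1)) * ν) ^ 2
        + (2 * κ₁ + 912 * d * κ₂) ≤ cLambda n CP Λ / 2)
    (hB8 : PairLandauGaugeB8Avg d 𝒞 L N b g s₁ s₂ 1 dom)
    (hsupp : ∀ k : ℕ, 1 ≤ k → ∀ V ∈ dom, ∀ UA UB : Site d → Fin d → (Matrix n n ℂ)ˣ,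
      IsMinimiser d 𝒞 L N k V UA → IsMinimiser d 𝒞 L N (k + 1) V UB → Regular d L N b g (k + 1) UB →
      ∀ (u : Site d → (Matrix n n ℂ)ˣ) (Z : Site d → Fin d → Matrix n n ℂ), LandauRepB8Avg L N k (cavg L UB) UA u Z s₁ s₂ 1 →
        IsUnitaryCfg (cavg L UB) ∧
        ∃ (X Nn : Site d → Fin d → Matrix n n ℂ) (α αN a : ℝ),
          DecomposedRepT 𝒞 L N k V UA UB u X Nn (slicB8 L N k (cavg L UB)) α αN ν κ₁ κ₂ a ∧
          pathΓ X Nn 0 = Z ∧ α ≤ 1 / 40 ∧ αN ≤ 1 / 100 ∧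
          (1 + 24 * Real.sqrt d * (Real.exp (10 * (α + αN)) - 1) * (L : ℝ) ^ k) ^ 2 + 48 * d * a * ((L : ℝ) ^ k) ^ 2 ≤ Λ ∧
          112 * (d : ℝ) * a * CP * ((L : ℝ) ^ k) ^ 2 ≤ 1 / (2 * (Fintype.card n : ℝ)) ∧
          SlicePoincare L k (cavg L UB) (slicB8 L N k (cavg L UB)) CP (periodBox (N * L ^ k)) ∧
          CurlPairedResidual L k (cavg L UB) (slicB8 L N k (cavg L UB)) (C' * residualScale d L N b g k) (periodBox (N * L ^ k))) :
    NE3EnergyRateWCov d 𝒞 L N b g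
      ((1 + (ν + 23 * Real.sqrt 2 * Real.sqrt (16 * d + 1) * (1 + ν))) * (4 / cLambda n CP Λ) * C') s₁ s₂ dom := by
  have hθ₀ : 0 ≤ ν + 23 * Real.sqrt 2 * Real.sqrt (16 * d + 1) * (1 + ν) := by positivity
  have hbudget' : 2 * Λ * (2 * (1 + 4 * Real.sqrt (16 * d + 1)) * ν) + Λ * (2 * (1 + 4 * Real.sqrt (16 * d + 1)) * ν) ^ 2
      + (2 * κ₁ + 912 * d * κ₂) + 2 * 0 ≤ cLambda n CP Λ / 2 := by simpa using hbudget
  refine ne3EnergyRateWCov_of_endpointChart_slice hd hL hN hCP hreg₁ hθ₀ hC' hbudget' ?_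
  intro k hk V hV UA UB hA hB hreg
  obtain ⟨u, Z, hZ⟩ := hB8 k hk V hV UA UB hA hB hreg
  obtain ⟨hW, X, Nn, α, αN, a, hdec, hΓ0, hα, hαN, hJ1, hJ2, hP, hres⟩ := hsupp k hk V hV UA UB hA hB hreg u Z hZ
  -- the product-path chart on `slicB8`, then the zero-extension of its path (global sup `10(α+αN)`)
  have hchart := endpointChart_of_decomposedRepT hL hN hW hdec
  have hchart' := endpointChart_congr_path (Γ' := extPath X Nn) hchart (fun t ht => extPath_of_mem ht) (isSkewDir_extPath X Nn)
    (isPeriodicDir_extPath hdec.perX hdec.perN)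
  have hsup : ∀ t (x : Site d) (μ : Fin d), ‖extPath X Nn t x μ‖ ≤ 10 * (α + αN) :=
    fun t x μ => norm_extPath_le hdec.skewX hdec.skewN hdec.supX hdec.supN hα hαN t x μ
  have hα' : 0 ≤ 10 * (α + αN) := by linarith [hdec.hα0, hdec.hαN0]
  -- the extended path starts at the B8 direction
  have h0 : extPath X Nn 0 = Z := by
    rw [extPath_of_mem (mem_window_of_mem_Icc ⟨le_rfl, zero_le_one⟩), hΓ0]
  refine ⟨hW, slicB8 L N k (cavg L UB), u, extPath X Nn, _, _, X, 10 * (α + αN), a,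
    fun Y hY => skew_of_mem_slicB8 hY, fun Y hY => periodic_of_mem_slicB8 hY, hα', hdec.ha, hchart', hsup, hJ1, hJ2, hP, hres, ?_, ?_⟩
  · intro κ x μ
    rw [h0]
    exact hZ.grad κ x μ
  · intro κ μ y
    rw [h0]
    have h2 := hZ.holder κ μ y
    rwa [rpow_two_add_one] at h2

end

end Summit.QuantumFields.BalabanUV.T4Continuum.NE3.PairLandauB8End
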